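import Literature.Probability.Percolation.VerticalSweep
import Literature.Probability.Percolation.TrackExchangeReflect
import HarnessLib

/-!
# Vertical crossings through a track exchange: both directions of the sweep

Grimmett–Manolescu, *Bond percolation on isoradial graphs* (PTRF 159 (2014) 273–327 =
arXiv:1204.0505), §6.3, proof of Lemma 6.9: "Without loss of generality, we may suppose that
`Σ_{j+1}`, applied to `Ψ_j(G^k)`, goes from left to right; a similar argument holds otherwise."
The files `TrackExchangeTop`, `VerticalSweep` treat the left-to-right sweep; this file adds the
right-to-left one as the conjugate by the reflection `(m, y) ↦ (-m, y)` of the strip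
(`TrackExchangeReflect`) and packages both, together with the trivial case of equal angles (no
exchange), behind one interface for the assembly of Proposition 6.8:

* `ExchangeData.refl` — the reflected exchange data (column angles `i ↦ -α(-1-i)`, row angles
  `π - β`), `refl_initial`, `refl_exchanged`, `refl_valid`;
* `ExchangeData.sweep₂` — the exchange of the tracks at levels `j-1`, `j` in whichever direction
  the angles dictate (`β_j > β_{j-1}`: `sweep`; `β_j < β_{j-1}`: `reflCfg ∘ refl.sweep ∘ reflCfg`;
  equal angles: the identity); `measurable_sweep₂`, `clean_sweep₂`, **`map_sweep₂`** (its law: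
  `P_{initial} ⊗ noise ↦ P_{exchanged}`);
* the record height is invariant under the reflection (`reaches_reflCfg_iff`, `hRec_reflCfg`),
  top witnesses reflect to top witnesses (`TopWit.map_reflL`);
* **`hRec_sweep₂_ge`** (GM14 (6.32)–(6.33)) and **`hRec_sweep₂_ge_of_topWit`** (GM14 (6.34),
  deterministic part) in both directions: the designated closed edge is `critEdge`
  (`e₃` of the face to the left of the top for a left-to-right sweep, its mirror image for a
  right-to-left one), the designated uniform variable is the one of the move at stage `critIdx`,
  and the favourable set is `critU` (`le_volume_critU`: probability `≥ sin²(ε/3)`);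
  `critEdge_notMem_edgesOf`-type facts needed for the conditioning are `lht`-level statements
  (`critEdge` has an endpoint of height `j` other than the top).

## References

* G. R. Grimmett, I. Manolescu, PTRF 159 (2014) 273–327, arXiv:1204.0505, §5.3 (directions of
  `Σ_j`), §6.3 (6.32)–(6.34).
-/

noncomputable section

namespace Literature.Probability.Percolation

open LatticeModels StarTriangle Real MeasureTheory

namespace TrackExchange

/-! ### The record height under the reflection of the strip -/

/-- Walks of labels in a symmetric domain reflect to walks of labels in it. [folklore] -/
theorem inDom_map_reflL {S : Set (ℤ × ℤ)} (hS : ∀ m y, (m, y) ∈ S → (-m, y) ∈ S) {W : List SV} (h : InDom S W) :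
    InDom S (W.map reflL) := by
  intro z hz
  rw [List.mem_map] at hz
  obtain ⟨w, hw, rfl⟩ := hz
  obtain ⟨a, rfl, ha⟩ := h w hw
  exact ⟨(-a.1, a.2), rfl, hS _ _ ha⟩

/-- **Reachability is invariant under the reflection** (symmetric domain). [folklore] -/
theorem reaches_reflCfg {S : Set (ℤ × ℤ)} (hS : ∀ m y, (m, y) ∈ S → (-m, y) ∈ S) {ω : Set (Sym2 SV)} {y : ℤ}
    (h : Reaches S ω y) : Reaches S (reflCfg ω) y := by
  obtain ⟨W, hW, hD, ⟨a, ha, ha0⟩, ⟨b, hb, hby⟩⟩ := h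
  refine ⟨W.map reflL, isWalk_reflW (x := (ω, W)) hW, inDom_map_reflL hS hD,
    ⟨(-a.1, a.2), by rw [head?_map_reflL, ha]; rfl, ha0⟩, ⟨(-b.1, b.2), by rw [getLast?_map_reflL, hb]; rfl, hby⟩⟩

/-- Reachability is invariant under the reflection, both ways. [folklore] -/
theorem reaches_reflCfg_iff {S : Set (ℤ × ℤ)} (hS : ∀ m y, (m, y) ∈ S → (-m, y) ∈ S) {ω : Set (Sym2 SV)} {y : ℤ} :
    Reaches S (reflCfg ω) y ↔ Reaches S ω y :=
  ⟨fun h => by simpa using reaches_reflCfg hS h, reaches_reflCfg hS⟩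

/-- **The record height is invariant under the reflection** (symmetric domain). [folklore] -/
theorem hRec_reflCfg {S : Set (ℤ × ℤ)} (hS : ∀ m y, (m, y) ∈ S → (-m, y) ∈ S) (N : ℕ) (ω : Set (Sym2 SV)) :
    hRec S N (reflCfg ω) = hRec S N ω := by
  unfold hRec
  simp only [reaches_reflCfg_iff hS]

/-- The trapezia are symmetric. [folklore] -/
theorem Dom_symm (c ℓ : ℤ) : ∀ m y, (m, y) ∈ Dom c ℓ → (-m, y) ∈ Dom c ℓ := fun _ _ h => neg_mem_Dom_iff.2 h

/-- `dropLast` commutes with `map`. [folklore] -/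
theorem dropLast_map_reflL (W : List SV) : (W.map reflL).dropLast = W.dropLast.map reflL := by
  rw [List.dropLast_eq_take, List.dropLast_eq_take, List.length_map, List.map_take]

/-- **Top witnesses reflect to top witnesses.** [folklore] -/
theorem TopWit.map_reflL {S : Set (ℤ × ℤ)} (hS : ∀ m y, (m, y) ∈ S → (-m, y) ∈ S) {ω : Set (Sym2 SV)} {y : ℤ}
    {W : List SV} (h : TopWit S ω y W) : TopWit S (reflCfg ω) y (W.map reflL) := by
  obtain ⟨a, ha, ha0⟩ := h.head
  obtain ⟨b, hb, hby⟩ := h.last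
  refine ⟨isWalk_reflW (x := (ω, W)) h.walk, inDom_map_reflL hS h.dom,
    ⟨(-a.1, a.2), by rw [head?_map_reflL, ha]; rfl, ha0⟩, ⟨(-b.1, b.2), by rw [getLast?_map_reflL, hb]; rfl, hby⟩, ?_⟩
  intro z hz
  rw [dropLast_map_reflL, List.mem_map] at hz
  obtain ⟨w, hw, rfl⟩ := hz
  have := h.below w hw
  rcases w with _ | ⟨m, y'⟩
  · simpa [lht] using this
  · simpa [lht] using this

namespace ExchangeData

variable (D : ExchangeData)

/-! ### The reflected exchange data -/

/-- **The reflected exchange data**: column angles `i ↦ -α(-1-i)`, row angles replaced by their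
supplements, same levels; the direction of the exchange is reversed. [cite: GrimmettManolescu2014Isoradial, §5.3] -/
@[reducible] def refl : ExchangeData := { M := D.M, α := fun i => -D.α (-1 - i), β := fun y => π - D.β y, j := D.j }

/-- Unfolding. [folklore] -/
@[simp] theorem refl_M : D.refl.M = D.M := rfl
/-- Unfolding. [folklore] -/
@[simp] theorem refl_j : D.refl.j = D.j := rfl
/-- Unfolding. [folklore] -/
@[simp] theorem refl_α (i : ℤ) : D.refl.α i = -D.α (-1 - i) := rfl
/-- Unfolding. [folklore] -/
@[simp] theorem refl_β (y : ℤ) : D.refl.β y = π - D.β y := rfl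
/-- Unfolding. [folklore] -/
@[simp] theorem refl_lo : D.refl.lo = π - D.lo := rfl
/-- Unfolding. [folklore] -/
@[simp] theorem refl_up : D.refl.up = π - D.up := rfl

/-- The weights of the reflected data are the original ones read through the reflection. [cite: GrimmettManolescu2014Isoradial, §4.6] -/
theorem refl_initial : D.refl.initial = canonicalWeight D.M (Θrefl fun i y => D.β y - D.α i) := by
  show canonicalWeight D.M (fun i y => (π - D.β y) - (-D.α (-1 - i))) = _
  congr 1
  funext i y
  rw [Θrefl]; ring

/-- The exchanged weights of the reflected data are the reflected exchanged weights. [cite: GrimmettManolescu2014Isoradial, §4.6] -/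
theorem refl_exchanged : D.refl.exchanged = canonicalWeight D.M (Θrefl fun i y => D.βExchanged y - D.α i) := by
  show canonicalWeight D.M (fun i y => ((fun y => π - D.β y) ∘ Equiv.swap (D.j - 1) D.j) y - (-D.α (-1 - i))) = _
  congr 1
  funext i y
  rw [Θrefl, Function.comp_apply]
  unfold ExchangeData.βExchanged
  rw [Function.comp_apply]
  ring

/-- **Two-sided bounded-angles hypotheses** of one exchange: `β_{j-1} - α_i`, `β_j - α_i ∈ (0, π)` on
the (nonempty) strip. [cite: GrimmettManolescu2014Isoradial, §5.3] -/
structure Valid₂ : Prop where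
  /-- the strip is nonempty -/
  M_pos : 0 < D.M
  /-- Bounded angles, lower track. -/
  lo : ∀ i : ℤ, -(D.M : ℤ) ≤ i → i < D.M → D.lo - D.α i ∈ Set.Ioo 0 π
  /-- Bounded angles, upper track. -/
  up : ∀ i : ℤ, -(D.M : ℤ) ≤ i → i < D.M → D.up - D.α i ∈ Set.Ioo 0 π

variable {D}

/-- A two-sided valid exchange with `β_j > β_{j-1}` is a valid left-to-right exchange. [cite: GrimmettManolescu2014Isoradial, §5.3] -/
theorem Valid₂.valid (h : D.Valid₂) (hdir : D.lo < D.up) : D.Valid := by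
  have hM : (0 : ℤ) < D.M := by exact_mod_cast h.M_pos
  have h0l := h.lo 0 (by omega) hM
  have h0u := h.up 0 (by omega) hM
  exact ⟨⟨by linarith, by linarith [h0l.1, h0u.2]⟩, h.lo, h.up⟩

/-- **A two-sided valid exchange with `β_j < β_{j-1}` reflects to a valid left-to-right exchange.**
[cite: GrimmettManolescu2014Isoradial, §5.3] -/
theorem Valid₂.refl_valid (h : D.Valid₂) (hdir : D.up < D.lo) : D.refl.Valid := by
  have hM : (0 : ℤ) < D.M := by exact_mod_cast h.M_pos
  have h0l := h.lo (-1) (by omega) (by omega)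
  have h0u := h.up (-1) (by omega) (by omega)
  refine ⟨⟨?_, ?_⟩, fun i hi hi' => ?_, fun i hi hi' => ?_⟩
  · show 0 < (π - D.up) - (π - D.lo); linarith
  · show (π - D.up) - (π - D.lo) < π; linarith [h0l.2, h0u.1]
  · have h1 := h.lo (-1 - i) (by simp at hi hi'; omega) (by simp at hi hi'; omega)
    show (π - D.lo) - (-D.α (-1 - i)) ∈ Set.Ioo 0 π
    exact ⟨by linarith [h1.2], by linarith [h1.1]⟩
  · have h1 := h.up (-1 - i) (by simp at hi hi'; omega) (by simp at hi hi'; omega)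
    show (π - D.up) - (-D.α (-1 - i)) ∈ Set.Ioo 0 π
    exact ⟨by linarith [h1.2], by linarith [h1.1]⟩

/-- The reflected data are two-sided valid. [folklore] -/
theorem Valid₂.refl (h : D.Valid₂) : D.refl.Valid₂ := by
  have hM : (0 : ℤ) < D.M := by exact_mod_cast h.M_pos
  refine ⟨h.M_pos, fun i hi hi' => ?_, fun i hi hi' => ?_⟩
  · have h1 := h.lo (-1 - i) (by simp at hi hi'; omega) (by simp at hi hi'; omega)
    show (π - D.lo) - (-D.α (-1 - i)) ∈ Set.Ioo 0 π
    exact ⟨by linarith [h1.2], by linarith [h1.1]⟩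
  · have h1 := h.up (-1 - i) (by simp at hi hi'; omega) (by simp at hi hi'; omega)
    show (π - D.up) - (-D.α (-1 - i)) ∈ Set.Ioo 0 π
    exact ⟨by linarith [h1.2], by linarith [h1.1]⟩

/-! ### The exchange in either direction -/

variable (D)

/-- **The track exchange `Σ_j` in whichever direction the angles dictate**: from left to right if
`β_j > β_{j-1}`, from right to left (the conjugate by the reflection) if `β_j < β_{j-1}`, nothing if
the two tracks have equal angles. [cite: GrimmettManolescu2014Isoradial, §5.3] -/
def sweep₂ (ω : Set (Sym2 SV)) (r : unitInterval × (Fin (2 * D.M) → unitInterval)) : Set (Sym2 SV) :=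
  if D.lo < D.up then D.sweep ω r else if D.up < D.lo then reflCfg (D.refl.sweep (reflCfg ω) r) else ω

/-- `sweep₂` is jointly measurable. [folklore] -/
theorem measurable_sweep₂ : Measurable (Function.uncurry D.sweep₂) := by
  have h : Function.uncurry D.sweep₂ = fun x =>
      if D.lo < D.up then D.sweep x.1 x.2 else if D.up < D.lo then reflCfg (D.refl.sweep (reflCfg x.1) x.2) else x.1 := by
    funext x; rfl
  rw [h]
  split_ifs
  · exact D.measurable_sweep
  · exact measurable_reflCfg.comp (D.refl.measurable_sweep.comp ((measurable_reflCfg.comp measurable_fst).prodMk measurable_snd))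
  · exact measurable_fst

variable {D}

/-- With equal angles the exchange changes no weight. [folklore] -/
theorem exchanged_eq_initial_of_eq (h : D.lo = D.up) : D.exchanged = D.initial := by
  unfold ExchangeData.exchanged ExchangeData.initial ExchangeData.βExchanged
  congr 1
  funext i y
  simp only [Function.comp_apply]
  by_cases h1 : y = D.j - 1
  · subst h1; rw [Equiv.swap_apply_left]; change D.up - _ = D.lo - _; rw [h]
  · by_cases h2 : y = D.j
    · subst h2; rw [Equiv.swap_apply_right]; change D.lo - _ = D.up - _; rw [h]
    · rw [Equiv.swap_apply_of_ne_of_ne h1 h2]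

/-- **`sweep₂` keeps configurations clean.** [cite: GrimmettManolescu2014Isoradial, §5.3] -/
theorem clean_sweep₂ (hV : D.Valid₂) {ω : Set (Sym2 SV)} (hc : Clean D.initial ω)
    (r : unitInterval × (Fin (2 * D.M) → unitInterval)) : Clean D.exchanged (D.sweep₂ ω r) := by
  unfold sweep₂
  split_ifs with h1 h2
  · exact clean_sweep (hV.valid h1) hc r
  · have hc' : Clean D.refl.initial (reflCfg ω) := by rw [refl_initial]; exact clean_reflCfg hc
    have := clean_sweep (hV.refl_valid h2) hc' r
    rw [refl_exchanged] at this
    have := clean_reflCfg this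
    rwa [Θrefl_Θrefl] at this
  · rw [exchanged_eq_initial_of_eq (le_antisymm (not_lt.1 h2) (not_lt.1 h1))]; exact hc

/-- **The law of `sweep₂`**: `P_{initial} ⊗ noise ↦ P_{exchanged}` (GM14: `Σ_j(G_{α,β}, P_{α,β}) =
(G_{α,σ_jβ}, P_{α,σ_jβ})`, in either direction). [cite: GrimmettManolescu2014Isoradial, §5.3] -/
theorem map_sweep₂ (hV : D.Valid₂) :
    ((prodBernoulli D.initial).prod D.sweepNoise).map (Function.uncurry D.sweep₂) = prodBernoulli D.exchanged := by
  unfold sweep₂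
  split_ifs with h1 h2
  · exact map_sweep (hV.valid h1)
  · -- conjugate by the reflection (`refl` is reducible, so that `D.refl.M` is `D.M` syntactically enough)
    have hfac : (Function.uncurry fun ω (r : unitInterval × (Fin (2 * D.M) → unitInterval)) =>
        reflCfg (D.refl.sweep (reflCfg ω) r)) = reflCfg ∘ (Function.uncurry D.refl.sweep ∘ Prod.map reflCfg id) := by
      funext x; rfl
    have hm1 : Measurable (Prod.map reflCfg (id : (unitInterval × (Fin (2 * D.M) → unitInterval)) → _)) :=
      measurable_reflCfg.prodMap measurable_id
    have h1 : ((prodBernoulli D.initial).prod D.sweepNoise).map (Prod.map reflCfg id) =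
        (prodBernoulli D.refl.initial).prod D.refl.sweepNoise := by
      rw [← Measure.map_prod_map _ _ measurable_reflCfg measurable_id, Measure.map_id,
        show D.initial = canonicalWeight D.M (fun i y => D.β y - D.α i) from rfl, prodBernoulli_map_reflCfg, ← refl_initial]
      rfl
    have h2 := map_sweep (hV.refl_valid h2)
    have h3 : (prodBernoulli D.refl.exchanged).map reflCfg = prodBernoulli D.exchanged := by
      rw [refl_exchanged, prodBernoulli_map_reflCfg, Θrefl_Θrefl]; rfl
    rw [hfac, ← Measure.map_map measurable_reflCfg (D.refl.measurable_sweep.comp hm1),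
      ← Measure.map_map D.refl.measurable_sweep hm1, h1, h2, h3]
  · rw [exchanged_eq_initial_of_eq (le_antisymm (not_lt.1 h2) (not_lt.1 h1))]
    have : (Function.uncurry fun (ω : Set (Sym2 SV)) (_ : unitInterval × (Fin (2 * D.M) → unitInterval)) => ω) = Prod.fst := by
      funext x; rfl
    rw [this, Measure.map_fst_prod, measure_univ, one_smul]

/-! ### The designated edge, move and favourable set, in either direction -/

variable (D)

/-- The edge `e₃` of the face to the *right* of the top `z = (x, j)`: `(x+2, j)–(x+1, j-1)` (the
mirror image of `leftFaceEdge`). [cite: GrimmettManolescu2014Isoradial, §6.3] -/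
def rightFaceEdge (x : ℤ) : Sym2 SV := s(some (x + 2, D.j), some (x + 1, D.j - 1))

/-- **The column offset of the risky predecessor**: a top reached from `(x + critSide, j - 1)` may
lose height (`+1` for a left-to-right sweep, `-1` for a right-to-left one; with equal angles there
is no exchange and no risky side, encoded by the impossible offset `3`). [cite: GrimmettManolescu2014Isoradial, §6.3] -/
def critSide : ℤ := if D.lo < D.up then 1 else if D.up < D.lo then -1 else 3

/-- **The designated closed edge** for a top at column `x`. [cite: GrimmettManolescu2014Isoradial, §6.3] -/
def critEdge (x : ℤ) : Sym2 SV := if D.lo < D.up then D.leftFaceEdge x else D.rightFaceEdge x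

/-- **The stage of the designated move** for a top at column `x` (the uniform variable with index
`t`, `-M + t = critIdx x`, drives it). [cite: GrimmettManolescu2014Isoradial, §6.3] -/
def critIdx (x : ℤ) : ℤ := if D.lo < D.up then x - 1 else -x - 1

/-- **The favourable set of the designated uniform variable** for a top at column `x`. [cite: GrimmettManolescu2014Isoradial, §6.3] -/
def critU (x : ℤ) : Set unitInterval := if D.lo < D.up then D.goodU x else D.refl.goodU (-x)

/-- `critU` is measurable. [folklore] -/
theorem measurableSet_critU (x : ℤ) : MeasurableSet (D.critU x) := by
  unfold critU; split_ifs <;> exact measurableSet_goodU _ _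

variable {D}

/-- The mirror image of `rightFaceEdge` is the `leftFaceEdge` of the reflected data at `-x`. [folklore] -/
theorem map_reflL_leftFaceEdge_refl (x : ℤ) : Sym2.map reflL (D.refl.leftFaceEdge (-x)) = D.rightFaceEdge x := by
  simp only [leftFaceEdge, rightFaceEdge, Sym2.map_mk, reflL_some]
  rw [show -(-x - 2) = x + 2 by ring, show -(-x - 1) = x + 1 by ring]

/-- **The favourable set has probability at least `sin²(ε/3)`** under the bounded-angles hypothesis
at the column of the designated move. [cite: GrimmettManolescu2014Isoradial, §6.3 (6.37)] -/
theorem le_volume_critU (hV : D.Valid₂) {ε : ℝ} (hε : 0 < ε)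
    (hbac : ∀ i : ℤ, -(D.M : ℤ) ≤ i → i < D.M → D.lo - D.α i ∈ Set.Icc ε (π - ε) ∧ D.up - D.α i ∈ Set.Icc ε (π - ε))
    {x : ℤ} (hpar : Even (x + D.j)) (hx : -(D.M : ℤ) + 2 ≤ x) (hx' : x + 2 ≤ D.M) (hdir : D.lo ≠ D.up) :
    ENNReal.ofReal (Real.sin (ε / 3) ^ 2) ≤ volume (D.critU x) := by
  unfold critU
  have hpar1 : ¬ Even (x - 1 + D.j) := fun ⟨r, hr⟩ => by obtain ⟨q, hq⟩ := hpar; omega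
  split_ifs with h1
  · obtain ⟨hl, hu⟩ := hbac (x - 1) (by omega) (by omega)
    exact le_volume_goodU (hV.valid h1) hpar1 (by omega) (by omega) hε hu hl
  · have h2 : D.up < D.lo := lt_of_le_of_ne (not_lt.1 h1) (Ne.symm hdir)
    have hpar2 : ¬ Even (-x - 1 + D.refl.j) := fun ⟨r, hr⟩ => by
      obtain ⟨q, hq⟩ := hpar; change -x - 1 + D.j = r + r at hr; omega
    obtain ⟨hl, hu⟩ := hbac (-1 - (-x - 1)) (by omega) (by omega)
    refine le_volume_goodU (hV.refl_valid h2) hpar2 (by simp; omega) (by simp; omega) hε ?_ ?_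
    · show (π - D.up) - (-D.α (-1 - (-x - 1))) ∈ Set.Icc ε (π - ε)
      exact ⟨by linarith [hu.2], by linarith [hu.1]⟩
    · show (π - D.lo) - (-D.α (-1 - (-x - 1))) ∈ Set.Icc ε (π - ε)
      exact ⟨by linarith [hl.2], by linarith [hl.1]⟩

/-- The weight of `e₃`: the odd diagonal of the rhombus `R_{x-2, j-1}`, `p_{β_{j-1} - α_{x-2}}`. [folklore] -/
theorem initial_leftFaceEdge {x : ℤ} (hpar : Even (x + D.j)) (hx : -(D.M : ℤ) ≤ x - 2) (hx' : x - 2 < D.M) :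
    D.initial (D.leftFaceEdge x) = angleWeight (D.lo - D.α (x - 2)) := by
  have hodd : ¬ Even (x - 2 + (D.j - 1)) := fun ⟨r, hr⟩ => by obtain ⟨q, hq⟩ := hpar; omega
  unfold leftFaceEdge ExchangeData.initial
  rw [show ((x - 2, D.j) : ℤ × ℤ) = (x - 2, D.j - 1 + 1) by simp, show ((x - 1, D.j - 1) : ℤ × ℤ) = (x - 2 + 1, D.j - 1) by ring_nf,
    canonicalWeight_diag_down D.M _ hodd hx hx']
  rfl

/-- The weight of the mirror image of `e₃`: the even diagonal of `R_{x+1, j-1}`, `p_{π-(β_{j-1} - α_{x+1})}`. [folklore] -/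
theorem initial_rightFaceEdge {x : ℤ} (hpar : Even (x + D.j)) (hx : -(D.M : ℤ) ≤ x + 1) (hx' : x + 1 < D.M) :
    D.initial (D.rightFaceEdge x) = angleWeight (π - (D.lo - D.α (x + 1))) := by
  have hev : Even (x + 1 + (D.j - 1)) := by obtain ⟨q, hq⟩ := hpar; exact ⟨q, by omega⟩
  unfold rightFaceEdge ExchangeData.initial
  rw [Sym2.eq_swap, show ((x + 2, D.j) : ℤ × ℤ) = (x + 1 + 1, D.j - 1 + 1) by ring_nf,
    canonicalWeight_diag_up D.M _ hev hx hx']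
  rfl

/-- **The designated edge is closed with probability at least `½ sin(ε/3)`**: its weight is
`p_{β_{j-1} - α_{x-2}}` or `p_{π-(β_{j-1}-α_{x+1})}`, whose complement is at least `½ sin(ε/3)` under
the bounded-angles hypothesis. [cite: GrimmettManolescu2014Isoradial, §6.3 (6.37)] -/
theorem half_sin_le_one_sub_critEdge {ε : ℝ} (hε : 0 < ε)
    (hbac : ∀ i : ℤ, -(D.M : ℤ) ≤ i → i < D.M → D.lo - D.α i ∈ Set.Icc ε (π - ε) ∧ D.up - D.α i ∈ Set.Icc ε (π - ε))
    {x : ℤ} (hpar : Even (x + D.j)) (hx : -(D.M : ℤ) + 2 ≤ x) (hx' : x + 2 ≤ D.M) :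
    Real.sin (ε / 3) / 2 ≤ 1 - (D.initial (D.critEdge x) : ℝ) := by
  unfold critEdge
  split_ifs with h1
  · rw [initial_leftFaceEdge hpar (by omega) (by omega)]
    obtain ⟨hl, -⟩ := hbac (x - 2) (by omega) (by omega)
    exact half_sin_third_le_one_sub_angleWeight hε hl.1 (by linarith [hl.2])
  · rw [initial_rightFaceEdge hpar (by omega) (by omega)]
    obtain ⟨hl, -⟩ := hbac (x + 1) (by omega) (by omega)
    exact half_sin_third_le_one_sub_angleWeight hε (by linarith [hl.2]) (by linarith [hl.1])

/-- The designated edge has an endpoint of height `j` in column `x ∓ 2`, hence is not an edge of a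
top witness whose top is `(x, j)` (its only vertex of height `j`). [folklore] -/
theorem critEdge_eq (x : ℤ) : ∃ m : ℤ, m ≠ x ∧ (some (m, D.j) : SV) ∈ D.critEdge x := by
  unfold critEdge leftFaceEdge rightFaceEdge
  split_ifs
  · exact ⟨x - 2, by omega, Sym2.mem_mk_left _ _⟩
  · exact ⟨x + 2, by omega, Sym2.mem_mk_left _ _⟩

/-! ### The record height after `sweep₂` -/

/-- **GM14 (6.32)–(6.33), either direction**: after `sweep₂` of level `j` the record height
(cap `N`, trapezium `Dom c (j+1)`) is at least the old one (trapezium `Dom c j`) unless the old one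
equals `j`, and at least the old one minus one in any case. [cite: GrimmettManolescu2014Isoradial, §6.3 (6.32)–(6.33)] -/
theorem hRec_sweep₂_ge (hV : D.Valid₂) {ω : Set (Sym2 SV)} (hc : Clean D.initial ω) {c : ℤ} {N : ℕ}
    (hc0 : 0 ≤ c) (hwide : c + N + 4 ≤ D.M) (hj : 1 ≤ D.j) (r : unitInterval × (Fin (2 * D.M) → unitInterval)) :
    ((hRec (Dom c D.j) N ω : ℤ) ≠ D.j → hRec (Dom c D.j) N ω ≤ hRec (Dom c (D.j + 1)) N (D.sweep₂ ω r)) ∧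
      hRec (Dom c D.j) N ω ≤ hRec (Dom c (D.j + 1)) N (D.sweep₂ ω r) + 1 := by
  unfold sweep₂
  split_ifs with h1 h2
  · exact hRec_sweep_ge (hV.valid h1) hc hc0 hwide hj r
  · -- conjugate by the reflection: the record height is reflection invariant
    have hc' : Clean D.refl.initial (reflCfg ω) := by rw [refl_initial]; exact clean_reflCfg hc
    have key := hRec_sweep_ge (D := D.refl) (hV.refl_valid h2) hc' (c := c) (N := N) hc0 (by simpa using hwide)
      (by simpa using hj) r
    rw [hRec_reflCfg (Dom_symm c D.j)] at key
    rw [hRec_reflCfg (Dom_symm c (D.j + 1))]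
    exact key
  · -- no exchange: the trapezium only grows
    have h00 : ((0 : ℤ), (0 : ℤ)) ∈ Dom c D.j := ⟨le_rfl, by simp only [abs_zero]; split_ifs <;> omega⟩
    have h0 : Reaches (Dom c D.j) ω 0 := reaches_zero h00
    have hle : hRec (Dom c D.j) N ω ≤ hRec (Dom c (D.j + 1)) N ω :=
      le_hRec (hRec_le h0) (reaches_mono (Dom_mono (by omega)) (reaches_hRec h0))
    exact ⟨fun _ => hle, by omega⟩

/-- **GM14 (6.34), deterministic part, either direction**: if the record equals the level `j` then,
for a top witness `W` of it (last vertex `(x, j)`, previous vertex `a`), the record is kept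
provided: when `a` is on the risky side (`a.1 = x + critSide`), the designated edge `critEdge x` is
closed and the uniform variable of the designated move (index `t` with `-M + t = critIdx x`) lies
in `critU x`. [cite: GrimmettManolescu2014Isoradial, §6.3 (6.34), Figs. 6.5–6.6] -/
theorem hRec_sweep₂_ge_of_topWit (hV : D.Valid₂) {ω : Set (Sym2 SV)} (hc : Clean D.initial ω) {c : ℤ} {N : ℕ}
    (hc0 : 0 ≤ c) (hwide : c + N + 4 ≤ D.M) (hj : 1 ≤ D.j) (hjN : D.j ≤ N) {W : List SV}
    (hW : TopWit (Dom c D.j) ω D.j W) {a : ℤ × ℤ} {x : ℤ}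
    (ha : W.dropLast.getLast? = some (some a)) (hb : W.getLast? = some (some (x, D.j)))
    (r : unitInterval × (Fin (2 * D.M) → unitInterval))
    (hgood : a.1 = x + D.critSide → D.critEdge x ∉ ω ∧ ∀ t : Fin (2 * D.M), -(D.M : ℤ) + t = D.critIdx x → r.2 t ∈ D.critU x) :
    D.j ≤ (hRec (Dom c (D.j + 1)) N (D.sweep₂ ω r) : ℤ) := by
  unfold sweep₂
  unfold critSide critEdge critIdx critU at hgood
  split_ifs at hgood ⊢ with h1 h2
  · exact hRec_sweep_ge_of_topWit (hV.valid h1) hc hwide hj hjN hW ha hb r hgood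
  · -- right to left: reflect the witness and use the left-to-right statement for `D.refl`
    have hc' : Clean D.refl.initial (reflCfg ω) := by rw [refl_initial]; exact clean_reflCfg hc
    have hW' : TopWit (Dom c D.refl.j) (reflCfg ω) D.refl.j (W.map reflL) := by
      simpa using hW.map_reflL (Dom_symm c D.j)
    have ha' : (W.map reflL).dropLast.getLast? = some (some (-a.1, a.2)) := by
      rw [dropLast_map_reflL, getLast?_map_reflL, ha]; rfl
    have hb' : (W.map reflL).getLast? = some (some (-x, D.refl.j)) := by
      rw [getLast?_map_reflL, hb]; rfl
    have key := hRec_sweep_ge_of_topWit (D := D.refl) (hV.refl_valid h2) hc' (c := c) (N := N)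
      (by simpa using hwide) (by simpa using hj) (by simpa using hjN) hW' ha' hb' r (fun h => ?_)
    · rw [hRec_reflCfg (Dom_symm c (D.j + 1))]
      exact key
    · -- the risky side of the reflected sweep is the left side of the original one
      simp only at h
      obtain ⟨h3, hu⟩ := hgood (by omega)
      refine ⟨fun h' => h3 ?_, fun t ht => ?_⟩
      · rw [mem_reflCfg_iff, map_reflL_leftFaceEdge_refl] at h'
        exact h'
      · have := hu t (by simpa using ht)
        exact this
  · -- no exchange
    have h00 : ((0 : ℤ), (0 : ℤ)) ∈ Dom c D.j := ⟨le_rfl, by simp only [abs_zero]; split_ifs <;> omega⟩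
    have h0 : Reaches (Dom c D.j) ω 0 := reaches_zero h00
    have h1' : ((D.j.toNat : ℕ) : ℤ) = D.j := by omega
    have hreach : Reaches (Dom c (D.j + 1)) ω ((D.j.toNat : ℕ) : ℤ) := by
      rw [h1']; exact reaches_mono (Dom_mono (by omega)) hW.reaches
    have := le_hRec (N := N) (by omega) hreach
    omega

end ExchangeData

end TrackExchange

end Literature.Probability.Percolation
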